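import Mathlib
import HarnessLib
import Literature.MathematicalPhysics.QuantumLattice.SectorisedIncrementBoundBinomialWeightedPrescribedPlateauSubLaplacian
import Summits.HubbardSuperconductivity.HubbardSuperconductivity.Theorems.KLProgrammeKLRegimeEngineTowerBlockStepWtFull

/-!
# Route `KLProgramme` — crux K3 ENGINE (stmt-HubbardSuperconductivity-20437 `KLRegimeEngineV17F2`), stub (b) / E1 interface (E2) in-tower route, located item
# «(E2)-ROUTE-TADPOLE» (k3c3-p2 g19, KL STATUS l.10793; k3c2-p3 g19 CONCUR l.10852): THE BINOMIAL WEIGHTED-PRESCRIBED DOOR AT A BLOCK STEP WITHOUT ITS ONE-LINE TERM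
# — `e^{Δ_Γ}G − G − Δ_Γ G` (at least two self-lines), the twin of `blockStep_firstOrder_wtFull_le` (…EngineTowerBlockStepWtFull, k3c2-p3 g12)
# (recipe «(E2)-POW3-TRACK» option (i), layer 3; cell gate-hubbard-kl, seat hubbard-kl-k3c3-p2 g19)

WHY.  The two-leg born size of a tower increment that the weight-generic doors export is FIRST ORDER in the block input's quartic kernel — the `m′ = q + 2` term of the
binomial door is the block TADPOLE `Δ_Γ 𝒱_{dk}` (its bare-`U` part exactly local) — so a `(1 + Λ·diam)^D`-weighted majorant of the full increment cannot carry the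
`U²`-per-block pure moments the (E2) reader needs.  With the three-piece split `Δ_Γ G + (e^{Δ_Γ}G − G − Δ_Γ G) + (effAction Γ G − e^{Δ_Γ}G)` the tadpole is booked
separately; this file is the model instance (block geometry `Γ = C^K_{(Λ_{J₂},Λ_{J₁}]}`, thin/fat families, plateau and parent facts discharged exactly as in
…EngineTowerBlockStepWtFull) of the Literature door for the SECOND piece:

* **`blockStep_geTwoLines_wtFull_le`** — `blockStep_firstOrder_wtFull_le` verbatim with `e^{Δ_Γ}G − G − Δ_Γ G` on the left and the binomial–Gram sum over the input
  degrees `m′ > q + 2` on the right (supplier `sum_filter_wt_norm_sectorAnalysis_gaussConv_sub_sub_laplacian_le_binomial_prescribed_of_plateau`).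
Composition of landed theorems; nothing about the model is asserted beyond them; nothing asserts (E2), any stub, K3 or superconductivity.
References: BGM 2006 (2.61)–(2.63), (2.66), (2.86)–(2.90), §2.7 (2.70)–(2.71a), §2.8 (2.76)–(2.84), App. A3 Lemma A3.1, §3 (3.2)–(3.8) [cite: BenfattoGiulianiMastropietro2006].
-/

noncomputable section

namespace Summit.HubbardSuperconductivity.HubbardSuperconductivity.Theorems.EngineV8

set_option linter.dupNamespace false -- summit = problem name (single-conjunct summit), D-0017

open Real Finset Literature.MathematicalPhysics.QuantumLattice Literature.Probability.LatticeModels GrassmannAlgebra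
open Summit.HubbardSuperconductivity.HubbardSuperconductivity.Theorems.KLProgrammeLegKernels
open Summit.HubbardSuperconductivity.HubbardSuperconductivity.Theorems.KLRegimeSplit
open Summit.HubbardSuperconductivity.HubbardSuperconductivity.Theorems.KLRegimeWick
open Summit.HubbardSuperconductivity.HubbardSuperconductivity.Theorems.TwoPointAssembly
open Literature.Probability.LatticeModels.BattleFederbush

variable {L M : ℕ} [NeZero L] [NeZero M] {Λ : Type*} [DecidableEq Λ] {wt : Finset Λ → ℝ}

/-- **THE BINOMIAL WEIGHTED-PRESCRIBED DOOR AT A BLOCK STEP WITHOUT ITS ONE-LINE TERM** (`e^{Δ_Γ}G − G − Δ_Γ G`: at least two self-contractions).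
Same geometry, child relation and parents count as `blockStep_firstOrder_wtFull_le`; even `G`; tree weight `wt`; degree `2(q+1)` output with legs `J`
prescribed to `τ″`, pinned leg `i ∉ J`; WEIGHTED PRESCRIBED input sizes `B m′ Fc`; weighted overlap `(cr, cc)`; Gram constant `κ ≥ 0`; the right side sums over
the input degrees `m′ > q + 2` only. [cite: BenfattoGiulianiMastropietro2006, (2.61)-(2.63), (2.66), (2.86)-(2.90), (3.2)-(3.8)] -/
theorem blockStep_geTwoLines_wtFull_le (hwt : IsTreeWeight wt) {β : ℝ} (hβ : 0 < β) (μ : ℝ) (K : TrigPolyC4v) {J₁ J₂ J' : ℕ}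
    (hJ₁ : 1 ≤ J₁) (hJ : J₁ ≤ J₂) (hJ' : J₁ ≤ J')
    (πi : SpaceTimeIdx L M × SectorLeg (sectorCount (J₁ - 1)) → Λ) (πo : SpaceTimeIdx L M × SectorLeg (sectorCount J') → Λ)
    (G : HubbardGrassmann L M) (hG : G ∈ evenPart ℂ (HubbardFieldIdx L M))
    {κ : ℝ} (hκ : 0 ≤ κ)
    (hGB : IsGramBoundedR ((sectorSubMatrix L M β (bgmFatMultiplier L M klE0 β (nambuXiCT L μ K) (J₁ - 1))).transpose *
      hubbardCovSliceCT L M β μ 0 K (klScale klE0 J₂) (klScale klE0 J₁) *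
        sectorSubMatrix L M β (bgmFatMultiplier L M klE0 β (nambuXiCT L μ K) (J₁ - 1))) κ)
    (B : ℕ → ℕ → ℝ) (hB0 : ∀ m' Fc, 0 ≤ B m' Fc)
    (hB : ∀ (m' Fc : ℕ) (E : Finset (Fin (2 * m' + 1 + 1))) (τ : Fin (2 * m' + 1 + 1) → SectorLeg (sectorCount (J₁ - 1)))
      (q : Fin (2 * m' + 1 + 1)), q ∈ E → E.card = Fc + 1 → ∀ y : SpaceTimeIdx L M,
        imagTimeWeight β M ^ (2 * m' + 1) *
          ∑ σ ∈ univ.filter (fun σ : Fin (2 * m' + 1 + 1) → SectorLeg (sectorCount (J₁ - 1)) => ∀ e ∈ E, σ e = τ e),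
            ∑ x ∈ univ.filter (fun x : Fin (2 * m' + 1 + 1) → SpaceTimeIdx L M => x q = y),
              wt ((univ.image fun i => (x i, σ i)).image πi) *
                ‖sectorisedKernel L M β (klAnisoFamily L M β μ K klE0 (J₁ - 1)) G (2 * m' + 1 + 1) σ x‖ ≤ B (m' + 1) Fc)
    {cr cc : ℝ} (hcc0 : 0 ≤ cc)
    (hrow' : ∀ X'', ∑ X', ‖(sectorAnalysisMatrix L M β (klAnisoFamily L M β μ K klE0 J') *
        sectorSubMatrix L M β (bgmFatMultiplier L M klE0 β (nambuXiCT L μ K) (J₁ - 1))) X'' X'‖ * wt {πo X'', πi X'} ≤ cr)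
    (hcol' : ∀ X', ∑ X'', ‖(sectorAnalysisMatrix L M β (klAnisoFamily L M β μ K klE0 J') *
        sectorSubMatrix L M β (bgmFatMultiplier L M klE0 β (nambuXiCT L μ K) (J₁ - 1))) X'' X'‖ * wt {πo X'', πi X'} ≤ cc)
    {q : ℕ} (i : Fin (2 * q + 1 + 1)) (J : Finset (Fin (2 * q + 1 + 1))) (hi : i ∉ J)
    (τ'' : Fin (2 * q + 1 + 1) → SectorLeg (sectorCount J')) (w'' : SpaceTimeIdx L M × SectorLeg (sectorCount J')) :
    ∑ X'' ∈ univ.filter (fun X'' : Fin (2 * q + 1 + 1) → SpaceTimeIdx L M × SectorLeg (sectorCount J') =>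
        X'' i = w'' ∧ ∀ j ∈ J, (X'' j).2 = τ'' j),
        wt ((univ.image X'').image πo) *
          ‖kernel ℂ (ExteriorAlgebra.map (Matrix.toLin' (sectorAnalysisMatrix L M β (klAnisoFamily L M β μ K klE0 J')))
            (gaussConv ℂ (hubbardCovSliceCT L M β μ 0 K (klScale klE0 J₂) (klScale klE0 J₁)) G - G -
              grassmannLaplacian ℂ (hubbardCovSliceCT L M β μ 0 K (klScale klE0 J₂) (klScale klE0 J₁)) G)) (2 * q + 1 + 1) X''‖ ≤
      cr * cc ^ (2 * q + 1) *
        ∑ m' ∈ range (Fintype.card (SpaceTimeIdx L M × SectorLeg (sectorCount (J₁ - 1))) / 2 + 1), (if q + 1 + 1 < m' then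
          ((((2 * (q + 1)).factorial : ℝ))⁻¹ * ((∏ j ∈ univ.filter (fun j : Fin (2 * (q + 1)) => j ∉ J), (2 * m' - (j : ℕ)) : ℕ) : ℝ)) *
            ((2 * m' : ℕ) : ℝ) ^ J.card * κ ^ (2 * m' - 2 * (q + 1)) *
              ((27 : ℝ) ^ J.card * (imagTimeWeight β M * B m' J.card)) else 0) := by
  classical
  have he : (0 : ℝ) < klE0 := by norm_num [klE0]
  have hkJ : J₁ - 1 ≤ J' := by omega
  exact sum_filter_wt_norm_sectorAnalysis_gaussConv_sub_sub_laplacian_le_binomial_prescribed_of_plateau hwt πi πo hβ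
    (klAnisoFamily L M β μ K klE0 (J₁ - 1)) (bgmFatMultiplier L M klE0 β (nambuXiCT L μ K) (J₁ - 1))
    (fun ω k => bgmFatMultiplier_mul_bgmMultiplier he β (nambuXiCT L μ K) (J₁ - 1) ω k)
    (fun k hk ω => klAnisoFamily_eq_zero_of_sum_eq_zero β μ K klE0 (J₁ - 1) k hk ω)
    (klAnisoFamily L M β μ K klE0 J') G hG _
    (fun X Y hXY => sum_klAnisoFamily_eq_one_of_blockSliceCT_ne_zero β μ K hJ₁ hJ X Y hXY)
    (fun ω' k hne => sum_klAnisoFamily_pred_eq_one_of_klAnisoFamily_ne_zero β μ K hJ₁ hJ' ω' k hne)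
    (fun ω'' ω' => ∃ q : FreqMomentum L M, klAnisoFamily L M β μ K klE0 J' ω'' q ≠ 0 ∧
      bgmFatMultiplier L M klE0 β (nambuXiCT L μ K) (J₁ - 1) ω' q ≠ 0)
    (fun X'' X' hne => overlap_of_sectorAnalysis_mul_sectorSub_ne_zero β _ _ X'' X' hne)
    (by norm_num) (fun ℓ'' => by convert card_parentsLeg_klAniso_le β μ K hkJ ℓ'' using 3)
    hκ hGB B hB0 hB hcc0 hrow' hcol' i J hi τ'' w''


end Summit.HubbardSuperconductivity.HubbardSuperconductivity.Theorems.EngineV8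

end
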